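import Mathlib
import Summits.Ventures.DiscreteObjects.Mahler.SmythIsolationStrict
import Summits.Ventures.DiscreteObjects.Mahler.SmythIsolationEquality
import Summits.Ventures.DiscreteObjects.Mahler.SmythIsolationPublished

/-!
# Smyth's theorem (McKee–Smyth Thm 12.1), all three parts in one statement (venture `DiscreteObjects`, target L)

Cell `pub-namedobj`, seat `pub-namedobj-mahler` (gen 9). Framing: lottery ticket; floor = certified
bounds/negative ranges.

[McKee–Smyth, *Around the Unit Circle*, Thm 12.1 p.205] (Smyth 1971): for `P(z) ≠ z` a nonreciprocal
irreducible polynomial with integer coefficients,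
(1) `M(P) ≥ M(z³ - z - 1) = θ₀ = 1.32471…`;
(2) (monic `P`) equality occurs precisely for `z^{3n} - z^n - 1`, `z^{3n} + z^{2n} - 1` and their `z ↦ -z`
    images — recorded here in DIVISIBILITY form, `P ∣ P₀(±X^n)` or `P ∣ Q₀(±X^n)` (`P₀ = 1 - z² + z³`,
    `Q₀ = 1 - z + z³`; the identification of the irreducible factors of these trinomials, i.e. their
    irreducibility (Ljunggren), is not formalised);
(3) if `M(P) > θ₀` then `M(P) > √((93 + √2249)/80) = 1.32487…`.

* `smyth_theorem_12_1` — the conjunction of (1), (2), (3) for an irreducible `P ∈ ℤ[X]` with `P(0) ≠ 0`,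
  `P.reverse ≠ ±P` (kernel files `SmythTheorem`, `SmythIsolationEquality`, `SmythIsolationStrict`);
* `NonreciprocalMahlerIsolationStrict` — part (3) typed verbatim (strict) in the vocabulary of the
  Literature named fact `NonreciprocalMahlerBound`, with `_holds`; it implies the non-strict
  `NonreciprocalMahlerIsolation` of `SmythIsolationPublished`.
-/

namespace Summit.Ventures.DiscreteObjects.Mahler

open Polynomial

/-- **Smyth's theorem** ([McKee–Smyth, Thm 12.1]; Smyth 1971), parts (1)–(3).  For an irreducible
`P ∈ ℤ[X]` with `P(0) ≠ 0` which is neither reciprocal nor antireciprocal: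
(1) `θ₀ ≤ M(P)`; (2) `M(P) = θ₀ ↔ P ∣ 1 - X^{2k} + aX^{3k} ∨ P ∣ 1 - aX^k + aX^{3k}` for some `k ≥ 1`,
`a = ±1`; (3) `M(P) = θ₀ ∨ √((93+√2249)/80) < M(P)`. -/
theorem smyth_theorem_12_1 {P : ℤ[X]} (hirr : Irreducible P) (h0 : P.coeff 0 ≠ 0)
    (h1 : P.reverse ≠ P) (h2 : P.reverse ≠ -P) :
    smythTheta ≤ intMahlerMeasure P ∧
    (intMahlerMeasure P = smythTheta ↔ ∃ k : ℕ, 1 ≤ k ∧ ∃ a : ℤ, (a = 1 ∨ a = -1) ∧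
      (P ∣ 1 - X ^ (2 * k) + C a * X ^ (3 * k) ∨ P ∣ 1 - C a * X ^ k + C a * X ^ (3 * k))) ∧
    (intMahlerMeasure P = smythTheta ∨ Real.sqrt ((93 + Real.sqrt 2249) / 80) < intMahlerMeasure P) :=
  ⟨intMahlerMeasure_ge_smythTheta_of_nonreciprocal h0 h1 h2,
    intMahlerMeasure_eq_smythTheta_iff_dvd hirr h0 h1 h2,
    intMahlerMeasure_eq_smythTheta_or_gt hirr h0 h1 h2⟩

/-- **Isolation of `θ₀` among nonreciprocal measures, as printed (strict)**
[cite: MckeeSmyth2021, Theorem 12.1 p.205] [file NumberTheory/MahlerMeasure/NonreciprocalBound]: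
for an irreducible `P ∈ ℤ[z]` with `P(0) ≠ 0` which is not reciprocal (`P.reverse ≠ ± P`),
"if `M(P(z)) > M(z³ - z - 1)` then `M(P(z)) > √((93 + √2249)/80) = 1.32487⋯`". -/
def NonreciprocalMahlerIsolationStrict : Prop :=
  ∀ P : ℤ[X], Irreducible P → P.coeff 0 ≠ 0 → P.reverse ≠ P → P.reverse ≠ -P →
    ((X ^ 3 - X - 1 : ℤ[X]).map (Int.castRingHom ℂ)).mahlerMeasure < (P.map (Int.castRingHom ℂ)).mahlerMeasure →
      Real.sqrt ((93 + Real.sqrt 2249) / 80) < (P.map (Int.castRingHom ℂ)).mahlerMeasure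

/-- **[McKee–Smyth, Thm 12.1, last part, strict] holds** (kernel proof: `SmythIsolationStrict`). -/
theorem nonreciprocalMahlerIsolationStrict_holds : NonreciprocalMahlerIsolationStrict :=
  smyth_isolation_published

/-- The strict printed form implies the non-strict form `NonreciprocalMahlerIsolation`. -/
theorem nonreciprocalMahlerIsolation_of_strict (h : NonreciprocalMahlerIsolationStrict) :
    NonreciprocalMahlerIsolation :=
  fun P hirr h0 h1 h2 hgt => (h P hirr h0 h1 h2 hgt).le

end Summit.Ventures.DiscreteObjects.Mahler
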